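import Mathlib
import HarnessLib
import Summits.Ventures.LatticeQCDFlow.Exactness.CPNSiteConditional

/-!
# The CP(N−1) link conditional is the von Mises law of the link's staple: the typed link sampler IS the chain's link heat bath

HONEST FRAMING: exact (Metropolis-corrected) sampling algorithms for lattice gauge theory;
figures of merit are autocorrelation/cost numbers at stated couplings and volumes; no
continuum-physics claim.

Venture `LatticeQCDFlow` (cell pub-lqcd), topic `Exactness`, FANOUT row 9 (eng-latcore, the
engine `latflow.core`).  NEW WORK of the cell over row 9's `CPNHeatBathErgodic.lean` /
`CPNSiteConditional.lean` (the lattice CP(N−1) action, its link terms) and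
`VMFSiteHeatBathGeneral.lean` (`vmfAt`, here on `S¹ ⊂ ℝ²`, `n = 0`).  Nothing is cited as a fact.

The link analogue of `CPNSiteConditional.lean` (simpler: each link variable enters exactly ONE term of
the action, linearly).  `cpn_2d.heatbath_links` / `cpn_kernel.c`: `b = c·z̄_s·z_t ∈ ℂ`, new
`λ = e^{i(arg b̄… )}`-rotated von Mises draw with `κ = |b|` (Best–Fisher, `BestFisherAngle.lean`).
Realified: the term of link `e` is `c_e(λ₀⟨z_s, z_t⟩ − λ₁⟨z_s, J z_t⟩) = ⟨λ, b_e⟩_{ℝ²}` with the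
STAPLE `b_e = c_e(⟨z_s, z_t⟩, −⟨z_s, J z_t⟩)`.

* `cpnStaple e ω ∈ ℝ²`; `cpnLinkTerm_eq_inner` — `T_e = ⟨λ_e, b_e⟩`; `cpnLinkRest e ω` — the other terms;
  `cpnAction_eq_link` — `S = −⟨λ_e, b_e⟩ + R_e`; `cpnStaple_update`, `cpnLinkRest_update` — neither reads `λ_e`;
* **`gibbsDensity_cpnAction_update_link`** — THE CONDITIONAL WEIGHT OF LINK `e` IS `e^{⟨ℓ, b_e⟩}` up to a
  factor constant in `ℓ`; by `vmfAt_norm_smul` (at `n = 0`) that density against the uniform circle is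
  the von Mises(–Fisher) law on `S¹` with `κ = ‖b_e‖` and mean direction `b_e/‖b_e‖` — the law the
  engine's Best–Fisher draw produces exactly (`BestFisherAngle.map_bestFisher_link`, in angle form).

NOT CLAIMED: the angle ↔ `S¹ ⊂ ℝ²` dictionary between `vonMisesLawAt κ φ₀` and `vmfAt 0 κ m`
(`circlePt`, `CircleUniformAngle.lean`; coordinates), the Symanzik action, floating point.
-/

namespace Summit.Ventures.LatticeQCDFlow.Exactness

open MeasureTheory ProbabilityTheory Metric Finset WithLp
open scoped ENNReal InnerProductSpace

section LinkConditional

variable {V E : Type*} [Fintype V] [Fintype E] [DecidableEq V] [DecidableEq E] {d : ℕ}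
  (src tgt : E → V) (J : EuclideanSpace ℝ (Fin (d + 2)) →L[ℝ] EuclideanSpace ℝ (Fin (d + 2))) (c : E → ℝ)

/-- **The staple of link `e`**: `b_e = c_e(⟨z_s, z_t⟩, −⟨z_s, J z_t⟩) ∈ ℝ²`. -/
noncomputable def cpnStaple (e : E) (ω : CPNConfig V E d) : EuclideanSpace ℝ (Fin 2) :=
  toLp 2 ![c e * ⟪siteVec ω (src e), siteVec ω (tgt e)⟫_ℝ, -(c e * ⟪siteVec ω (src e), J (siteVec ω (tgt e))⟫_ℝ)]

/-- **The rest of the action** for link `e`: all other links' terms. -/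
noncomputable def cpnLinkRest (e : E) (ω : CPNConfig V E d) : ℝ :=
  -∑ e' ∈ univ.erase e, cpnLinkTerm src tgt J c ω e'

variable {src tgt}

omit [Fintype V] [Fintype E] [DecidableEq V] [DecidableEq E] in
/-- The term of link `e` is linear in `λ_e`: `T_e = ⟨λ_e, b_e⟩`. -/
theorem cpnLinkTerm_eq_inner (e : E) (ω : CPNConfig V E d) :
    cpnLinkTerm src tgt J c ω e = ⟪linkVec ω e, cpnStaple src tgt J c e ω⟫_ℝ := by
  rw [cpnLinkTerm, cpnStaple, PiLp.inner_apply (linkVec ω e), Fin.sum_univ_two]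
  simp only [Matrix.cons_val_zero, Matrix.cons_val_one, RCLike.inner_apply, conj_trivial]
  ring

omit [Fintype V] [DecidableEq V] in
/-- **Decomposition of the action at a link**: `S = −⟨λ_e, b_e⟩ + R_e`. -/
theorem cpnAction_eq_link (e : E) (ω : CPNConfig V E d) :
    cpnAction src tgt J c ω = -⟪linkVec ω e, cpnStaple src tgt J c e ω⟫_ℝ + cpnLinkRest src tgt J c e ω := by
  rw [cpnAction_eq_sum, cpnLinkRest, ← cpnLinkTerm_eq_inner, ← Finset.add_sum_erase univ _ (mem_univ e)]
  ring

omit [Fintype V] [Fintype E] in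
/-- Updating link `e` does not change the sites … -/
theorem siteVec_update_link (e : E) (w : V) (ω : CPNConfig V E d) (ℓ : CPNVar V E d (Sum.inr e)) :
    siteVec (Function.update ω (Sum.inr e) ℓ) w = siteVec ω w := by
  unfold siteVec
  rw [Function.update_of_ne Sum.inl_ne_inr]

omit [Fintype V] [Fintype E] in
/-- … reads back the new value at `e` … -/
theorem linkVec_update_self (e : E) (ω : CPNConfig V E d) (ℓ : CPNVar V E d (Sum.inr e)) :
    linkVec (Function.update ω (Sum.inr e) ℓ) e = ℓ.val := by
  unfold linkVec
  rw [Function.update_self]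

omit [Fintype V] [Fintype E] in
/-- … and does not change the other links. -/
theorem linkVec_update_of_ne {e e' : E} (h : e' ≠ e) (ω : CPNConfig V E d) (ℓ : CPNVar V E d (Sum.inr e)) :
    linkVec (Function.update ω (Sum.inr e) ℓ) e' = linkVec ω e' := by
  unfold linkVec
  rw [Function.update_of_ne (fun h' => h (Sum.inr_injective h'))]

omit [Fintype V] [Fintype E] in
/-- **The staple does not read `λ_e`.** -/
theorem cpnStaple_update (e : E) (ω : CPNConfig V E d) (ℓ : CPNVar V E d (Sum.inr e)) :
    cpnStaple src tgt J c e (Function.update ω (Sum.inr e) ℓ) = cpnStaple src tgt J c e ω := by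
  unfold cpnStaple
  rw [siteVec_update_link, siteVec_update_link]

omit [Fintype V] in
/-- **The rest does not read `λ_e`.** -/
theorem cpnLinkRest_update (e : E) (ω : CPNConfig V E d) (ℓ : CPNVar V E d (Sum.inr e)) :
    cpnLinkRest src tgt J c e (Function.update ω (Sum.inr e) ℓ) = cpnLinkRest src tgt J c e ω := by
  unfold cpnLinkRest
  congr 1
  refine sum_congr rfl fun e' he' => ?_
  have hne : e' ≠ e := (mem_erase.1 he').1
  simp only [cpnLinkTerm, linkVec_update_of_ne hne, siteVec_update_link]

omit [Fintype V] in
/-- **THE CONDITIONAL WEIGHT OF LINK `e` IS `e^{⟨ℓ, b_e⟩}` UP TO A FACTOR CONSTANT IN `ℓ`**: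
`e^{−S(ω | λ_e := ℓ)} = e^{⟨ℓ, b_e(ω)⟩} · e^{−R_e(ω)}`; against the uniform circle that is the von
Mises law with `κ = ‖b_e‖`, mean direction `b_e/‖b_e‖` (`vmfAt_norm_smul` at `n = 0`). -/
theorem gibbsDensity_cpnAction_update_link (e : E) (ω : CPNConfig V E d) (ℓ : CPNVar V E d (Sum.inr e)) :
    gibbsDensity (cpnAction src tgt J c) (Function.update ω (Sum.inr e) ℓ) =
      ENNReal.ofReal (Real.exp ⟪linkVec (Function.update ω (Sum.inr e) ℓ) e, cpnStaple src tgt J c e ω⟫_ℝ) *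
        ENNReal.ofReal (Real.exp (-cpnLinkRest src tgt J c e ω)) := by
  rw [gibbsDensity, cpnAction_eq_link J c e, cpnStaple_update, cpnLinkRest_update,
    ← ENNReal.ofReal_mul (Real.exp_pos _).le, ← Real.exp_add]
  congr 2
  ring

/-- **The link conditional density is a von Mises(–Fisher) law on the circle**: for `b ≠ 0`, the
density `e^{⟨ℓ, b⟩}` against the surface measure of `S¹` is `vmfAt 0 ‖b‖ (b/‖b‖)`. -/
theorem vmfAt_circle_norm_smul {b : EuclideanSpace ℝ (Fin 2)} (hb : b ≠ 0) :
    vmfAt 0 ‖b‖ (‖b‖⁻¹ • b) =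
      ((volume : Measure (EuclideanSpace ℝ (Fin 2))).toSphere).withDensity
        fun ℓ => ENNReal.ofReal (Real.exp ⟪(ℓ : EuclideanSpace ℝ (Fin 2)), b⟫_ℝ) :=
  vmfAt_norm_smul (d := 0) hb

end LinkConditional

end Summit.Ventures.LatticeQCDFlow.Exactness
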